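import Summits.NavierStokesRegularity.NavierStokesRegularity.Theorems.StrainDoorsTypeITangentTwist
import HarnessLib

/-!
# StrainDoorsTypeITangentMaster — PART M §M6: THE `C²` MASTER EXTRACTION AT NEAR-RECORD POINTS

nsreg-p1 g36, ROUND-63 (helper lane of `stmt-NavierStokesRegularity-0056`, rung N0; 0 ledger writes by the
planner — text for the S-lane, `--supports stmt-NavierStokesRegularity-0056 --as helper`; tree file 2 of 5 of
ROUND-63, an ENGINE with no in-round consumer (landing optional, LEAD's call); bodies farm-certified inside
`r63/StrainDoorsR63All.lean`, rc 0 · 0 warn · 0 sorry, std axioms).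

* `IsTypeITangentPeak.fderiv_norm_curl_eq_zero` — Fermat at the tangent peak: `∇|ω̄|(z̄) = 0`;
* ★★ `typeI_nearRecord_extraction_master` — ONE extraction exporting everything the near-record laws of PART L /
  PART M need: from near-record points `(t_j, x_j)` of classical Type-I solutions (one `C₀`; scale-invariant
  vorticity within `δ_j → 0` of a bound `W_j ≥ w₀ > 0` of the vorticity number) one obtains a member `(v, z̄)` of the
  Type-I tangent peak class with `ρ̄ ≥ w₀`, `∇v(−1,·)` differentiable with derivative `∇∇v(−1,·)`, and a subsequence
  `θ` with scales `λ_j² = 0 − t_{θ j}`, rescaled points `z_j → z̄` (`λ_j z_j = x_{θ j}`), `ω ≠ 0` at the points, and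
  convergence AT THE MOVING POINTS of the rescaled vorticity, gradient and Hessian:
  `ω_j'(−1,z_j) → ω̄(z̄)`, `∇u_j'(−1,z_j) → ∇v(−1,z̄)`, `∇∇u_j'(−1,z_j) → ∇∇v(−1,z̄)`.
  Every `C²`-continuous scale-invariant functional of `(ω, ∇u, ∇∇u)` at near-record points therefore converges to
  its value at the peak (PART L's stretching law, §M5's twist laws and any future second-order law are instances).

WHAT THIS IS NOT: a compactness lemma; nothing here excludes a blow-up; `0056` / `10661` / NS regularity are NOT
proved.  No new definitions; no sorry.
[cite: KochNadirashviliSereginSverak2009, §2 p. 5, (4.11), Lemma 6.1; ChaeWolf2017RemovingDSS, §3 Step 2]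
-/

noncomputable section

open MeasureTheory Set Function Filter Metric Real InnerProductSpace
open _root_.Topology
open scoped ENNReal NNReal RealInnerProductSpace ContDiff Laplacian
open Literature.Analysis Literature.Analysis.FluidPDE
open Literature.Analysis.FluidPDE.VorticityDirectionDynamics

set_option linter.dupNamespace false
set_option maxSynthPendingDepth 3

namespace Summit.NavierStokesRegularity.NavierStokesRegularity.Theorems.StrainDoors

open Summit.NavierStokesRegularity.NavierStokesRegularity.Theorems.ArgmaxDoors

/-! ## §M6 The `C²` master extraction at near-record points -/

/-- **At a Type-I tangent peak the vorticity modulus is spatially critical**: `D|ω_v(−1,·)|(z̄) = 0`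
(Fermat at the spatial maximum `|ω_v(−1,·)| ≤ |ω_v(−1,z̄)|` of `IsTypeITangentPeak.record_identity`). [folklore] -/
theorem IsTypeITangentPeak.fderiv_norm_curl_eq_zero {C₀ : ℝ}
    {v : ℝ → (EuclideanSpace ℝ (Fin 3)) → (EuclideanSpace ℝ (Fin 3))} {zbar : EuclideanSpace ℝ (Fin 3)}
    (h : IsTypeITangentPeak C₀ v zbar) :
    fderiv ℝ (fun y => ‖curl (v (-1)) y‖) zbar = 0 := by
  obtain ⟨-, hmaxX, -⟩ := h.record_identity
  have hloc : IsLocalMax (fun y => ‖curl (v (-1)) y‖) zbar := Filter.Eventually.of_forall hmaxX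
  exact hloc.fderiv_eq_zero

/-- ★★ **THE `C²` MASTER EXTRACTION AT NEAR-RECORD POINTS.**  Same hypotheses as `typeI_nearRecord_extraction`
(points of classical Type-I solutions, one constant `C₀`, whose scale-invariant vorticity comes within `δ_j → 0` of
an upper bound `W_j ≥ w₀ > 0` of the vorticity number, `δ_j ≤ w₀/2`).  Conclusion, with everything a successor needs
exported: a member `(v, z̄)` of the Type-I tangent peak class with `ρ̄ ≥ w₀` and `v(−1,·) ∈ C²` (pointwise
`HasFDerivAt` of `∇v(−1,·)`), a subsequence `θ`, the Navier–Stokes rescaling factors `λ_j = √(0 − t_{θj})` and the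
rescaled points `z_j = x_{θj}/λ_j → z̄`, such that for the rescaled solutions `u'_j = λ_j u_{θj}(λ_j²·, λ_j·)` at
time `−1` and at the MOVING points `z_j`: `ω(u'_j)(z_j) ≠ 0`, and the vorticities, velocity GRADIENTS and velocity
HESSIANS converge to those of `v(−1,·)` at `z̄`.  Every near-record law on `u` (stretching PART L, twist §M5,
modulus gradient below, …) is a few lines from this statement plus a scale identity. [new-as-typed] -/
theorem typeI_nearRecord_extraction_master {C₀ w₀ : ℝ} (hw₀ : 0 < w₀)
    {u : ℕ → ℝ → (EuclideanSpace ℝ (Fin 3)) → (EuclideanSpace ℝ (Fin 3))}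
    {p : ℕ → ℝ → (EuclideanSpace ℝ (Fin 3)) → ℝ} {W t δ : ℕ → ℝ} {x : ℕ → EuclideanSpace ℝ (Fin 3)}
    (hsol : ∀ j, IsClassicalNSSolutionOn (Iio 0) 1 0 (u j) (p j)) (hI : ∀ j, HasTypeIDecay C₀ (u j))
    (hdom : ∀ j, ∀ s : ℝ, s < 0 → ∀ y, (0 - s) * ‖curl (u j s) y‖ ≤ W j) (hW : ∀ j, w₀ ≤ W j)
    (ht : ∀ j, t j < 0) (hnear : ∀ j, W j - δ j ≤ (0 - t j) * ‖curl (u j (t j)) (x j)‖)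
    (hδ1 : ∀ j, δ j ≤ w₀ / 2) (hδ : Tendsto δ atTop (𝓝 0)) :
    ∃ (v : ℝ → (EuclideanSpace ℝ (Fin 3)) → (EuclideanSpace ℝ (Fin 3))) (zbar : EuclideanSpace ℝ (Fin 3)),
      IsTypeITangentPeak C₀ v zbar ∧ w₀ ≤ ‖curl (v (-1)) zbar‖ ∧
      (∀ y, HasFDerivAt (fderiv ℝ (v (-1))) (fderiv ℝ (fderiv ℝ (v (-1))) y) y) ∧
      ∃ (θ : ℕ → ℕ) (lam : ℕ → ℝ) (z : ℕ → EuclideanSpace ℝ (Fin 3)),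
        StrictMono θ ∧ (∀ j, 0 < lam j) ∧ (∀ j, lam j ^ 2 = 0 - t (θ j)) ∧ (∀ j, lam j • z j = x (θ j)) ∧
        Tendsto z atTop (𝓝 zbar) ∧
        (∀ j, curl (nsRescale (lam j) (u (θ j)) (-1)) (z j) ≠ 0) ∧
        Tendsto (fun j => curl (nsRescale (lam j) (u (θ j)) (-1)) (z j)) atTop (𝓝 (curl (v (-1)) zbar)) ∧
        Tendsto (fun j => fderiv ℝ (nsRescale (lam j) (u (θ j)) (-1)) (z j)) atTop
          (𝓝 (fderiv ℝ (v (-1)) zbar)) ∧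
        Tendsto (fun j => fderiv ℝ (fderiv ℝ (nsRescale (lam j) (u (θ j)) (-1))) (z j)) atTop
          (𝓝 (fderiv ℝ (fderiv ℝ (v (-1))) zbar)) := by
  have hC₀ : 0 ≤ C₀ := HasTypeIDecay.nonneg' (hI 0)
  -- rescale every point to time `-1` (as in §L2/§M4)
  obtain ⟨lam, hlam⟩ : ∃ lam : ℕ → ℝ, lam = fun j => √(0 - t j) := ⟨_, rfl⟩
  have hlam0 : ∀ j, 0 < lam j := fun j => by rw [hlam]; exact Real.sqrt_pos.mpr (by linarith [ht j])
  have hlam2 : ∀ j, lam j ^ 2 = 0 - t j := fun j => by rw [hlam]; exact Real.sq_sqrt (by linarith [ht j])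
  obtain ⟨u', hu'⟩ : ∃ u' : ℕ → ℝ → (EuclideanSpace ℝ (Fin 3)) → (EuclideanSpace ℝ (Fin 3)),
      u' = fun j => nsRescale (lam j) (u j) := ⟨_, rfl⟩
  obtain ⟨z, hz⟩ : ∃ z : ℕ → EuclideanSpace ℝ (Fin 3), z = fun j => (lam j)⁻¹ • x j := ⟨_, rfl⟩
  have hcl : ∀ j, IsClassicalNSSolutionOn (Iio 0) 1 0 (u' j) (nsRescalePressure (lam j) (p j)) := fun j => by
    rw [hu']; exact (typeI_class_nsRescale (hlam0 j) (hsol j) (hI j)).1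
  have hIj : ∀ j, HasTypeIDecay C₀ (u' j) := fun j => by
    rw [hu']; exact (typeI_class_nsRescale (hlam0 j) (hsol j) (hI j)).2
  have hxz : ∀ j, lam j • z j = x j := fun j => by rw [hz]; exact smul_inv_smul₀ (hlam0 j).ne' _
  have ht1 : ∀ j, lam j ^ 2 * (-1) = t j := fun j => by rw [hlam2]; ring
  have hnum : ∀ j, ∀ s : ℝ, s < 0 → ∀ y, (0 - s) * ‖curl (u' j s) y‖ ≤ W j := fun j s hs y => by
    rw [hu']; dsimp only
    rw [vorticityNumber_nsRescale]
    have hs' : lam j ^ 2 * s < 0 := mul_neg_of_pos_of_neg (pow_pos (hlam0 j) 2) hs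
    exact hdom j _ hs' _
  have hcurl' : ∀ j, curl (u' j (-1)) (z j) = (0 - t j) • curl (u j (t j)) (x j) := fun j => by
    rw [hu']; dsimp only
    rw [curl_eq_curlCLM, curl_eq_curlCLM, fderiv_nsRescale, map_smul, ht1, hxz, hlam2]
  have hnorm' : ∀ j, ‖curl (u' j (-1)) (z j)‖ = (0 - t j) * ‖curl (u j (t j)) (x j)‖ := fun j => by
    rw [hcurl', norm_smul, Real.norm_of_nonneg (by linarith [ht j])]
  have hnear' : ∀ j, W j - δ j ≤ ‖curl (u' j (-1)) (z j)‖ := fun j => by rw [hnorm']; exact hnear j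
  -- the vorticity does not vanish at the points
  have hpos : ∀ j, 0 < W j - δ j := fun j => by have := hδ1 j; have := hW j; linarith
  have hne' : ∀ j, curl (u' j (-1)) (z j) ≠ 0 := fun j => by
    rw [← norm_pos_iff]; linarith [hnear' j, hpos j]
  -- the rescaled points stay in a ball (near-records live in a parabolic cone, PART G)
  obtain ⟨R, hR, hcone⟩ := typeI_vorticity_nearRecord_cone hC₀ (w₀ / 2) (by positivity)
  have hzR : ∀ j, ‖z j‖ < R := fun j => by
    have hη : w₀ / 2 ≤ (0 - (-1)) * ‖curl (u' j (-1)) (z j)‖ := by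
      have h1 := hnear' j; have h2 := hδ1 j; have h3 := hW j
      norm_num; linarith
    have h := hcone (hcl j) (hIj j) (-1) (by norm_num) (z j) hη
    norm_num at h
    exact h
  obtain ⟨B, hB, hBb⟩ := typeI_vorticityNumber_bound hC₀
  have hWle : ∀ j, W j ≤ B + w₀ := fun j => by
    have h1 := hnear' j
    have h2 := hBb (hcl j) (hIj j) (-1) (by norm_num) (z j)
    have h3 : δ j ≤ w₀ := (hδ1 j).trans (by linarith)
    norm_num at h2
    linarith
  -- tangent field with gradients (PART H), then Hessians along a further subsequence (§M2)
  obtain ⟨φ, hφ, v, hvc, hlimv, hdiff, hlimD, hcurlmv, hvI, hweak, -⟩ := typeI_tangent_field hC₀ hcl hIj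
  have h14 : (-1 : ℝ) ≤ -(1 / 4 : ℝ) := by norm_num
  obtain ⟨ψH, hψH, hHv, hHmv⟩ :=
    typeI_tangent_hessian hC₀ (fun n => hcl (φ n)) (fun n => hIj (φ n)) (v := v) h14 (hlimD (-1) h14)
  have hψH' : Tendsto ψH atTop atTop := hψH.tendsto_atTop
  -- Bolzano–Weierstrass on the pairs (centre, number)
  have hmem : ∀ n, ((z (φ (ψH n)), W (φ (ψH n))) : EuclideanSpace ℝ (Fin 3) × ℝ) ∈
      Metric.closedBall (0 : EuclideanSpace ℝ (Fin 3) × ℝ) (max R (B + w₀)) := fun n => by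
    rw [mem_closedBall_zero_iff, Prod.norm_def]
    refine max_le_max (hzR _).le ?_
    rw [Real.norm_of_nonneg (by linarith [hW (φ (ψH n))])]
    exact hWle _
  obtain ⟨q, -, ψ, hψ, hq⟩ := tendsto_subseq_of_bounded (Metric.isBounded_closedBall) hmem
  have hψ' : Tendsto ψ atTop atTop := hψ.tendsto_atTop
  have hzlim : Tendsto (fun j => z (φ (ψH (ψ j)))) atTop (𝓝 q.1) := (continuous_fst.tendsto q).comp hq
  have hWlim : Tendsto (fun j => W (φ (ψH (ψ j)))) atTop (𝓝 q.2) := (continuous_snd.tendsto q).comp hq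
  obtain ⟨zbar, hzbar⟩ : ∃ zbar : EuclideanSpace ℝ (Fin 3), zbar = q.1 := ⟨_, rfl⟩
  obtain ⟨Wbar, hWbar⟩ : ∃ Wbar : ℝ, Wbar = q.2 := ⟨_, rfl⟩
  rw [← hzbar] at hzlim
  rw [← hWbar] at hWlim
  have hWbar0 : w₀ ≤ Wbar := ge_of_tendsto' hWlim fun j => hW _
  -- uniform spatial Lipschitz bounds for vorticities, gradients and Hessians at `t = -1` (PART H, §M1)
  obtain ⟨K₂, L₁, hK₂, hL₁, hG⟩ := exists_uniform_gradLipschitz hC₀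
  have hgl : ∀ j, LipschitzWith (Real.toNNReal (‖curlCLM‖ * K₂))
      (fun y => curl (u' (φ (ψH (ψ j))) (-1)) y) := fun j =>
    LipschitzWith.of_dist_le_mul fun a b => by
      rw [dist_eq_norm, dist_eq_norm, Real.coe_toNNReal _ (by positivity)]
      exact curl_sub_le_of_fderiv_lipschitz ((hG (hcl _) (hIj _)).1 (-1) h14) a b
  have hgl' : ∀ j, LipschitzWith (Real.toNNReal K₂) (fun y => fderiv ℝ (u' (φ (ψH (ψ j))) (-1)) y) :=
    fun j => LipschitzWith.of_dist_le_mul fun a b => by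
      rw [dist_eq_norm, dist_eq_norm, Real.coe_toNNReal _ hK₂]
      exact (hG (hcl _) (hIj _)).1 (-1) h14 a b
  obtain ⟨K₂', K₃', hK₂', hK₃', hH⟩ := exists_uniform_hessLipschitz hC₀
  have hHl : ∀ j, LipschitzWith (Real.toNNReal K₃')
      (fun y => fderiv ℝ (fderiv ℝ (u' (φ (ψH (ψ j))) (-1))) y) := fun j =>
    LipschitzWith.of_dist_le_mul fun a b => by
      rw [dist_eq_norm, dist_eq_norm, Real.coe_toNNReal K₃' hK₃']
      exact (hH (hcl _) (hIj _)).2 (-1) h14 a b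
  -- moving-point convergence of vorticity, gradient and Hessian at the rescaled points
  have hconvω : Tendsto (fun j => curl (u' (φ (ψH (ψ j))) (-1)) (z (φ (ψH (ψ j))))) atTop
      (𝓝 (curl (v (-1)) zbar)) :=
    ChaeWolf.tendsto_apply_of_tendsto hgl hzlim
      (((hcurlmv (-1) h14 (fun _ => zbar) zbar tendsto_const_nhds).comp hψH').comp hψ')
  have hconvA : Tendsto (fun j => fderiv ℝ (u' (φ (ψH (ψ j))) (-1)) (z (φ (ψH (ψ j))))) atTop
      (𝓝 (fderiv ℝ (v (-1)) zbar)) :=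
    ChaeWolf.tendsto_apply_of_tendsto hgl' hzlim (((hlimD (-1) h14 zbar).comp hψH').comp hψ')
  have hconvH : Tendsto (fun j => fderiv ℝ (fderiv ℝ (u' (φ (ψH (ψ j))) (-1))) (z (φ (ψH (ψ j))))) atTop
      (𝓝 (fderiv ℝ (fderiv ℝ (v (-1))) zbar)) :=
    ChaeWolf.tendsto_apply_of_tendsto hHl hzlim ((hHmv (fun _ => zbar) zbar tendsto_const_nhds).comp hψ')
  -- the limit point is an attained record of `v`: `‖ω_v(-1, zbar)‖ = Wbar`
  have hup : ∀ j, ‖curl (u' (φ (ψH (ψ j))) (-1)) (z (φ (ψH (ψ j))))‖ ≤ W (φ (ψH (ψ j))) := fun j => by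
    have h := hnum (φ (ψH (ψ j))) (-1) (by norm_num) (z (φ (ψH (ψ j))))
    norm_num at h
    exact h
  have hlow : Tendsto (fun j => W (φ (ψH (ψ j))) - δ (φ (ψH (ψ j)))) atTop (𝓝 Wbar) := by
    have h0 : Tendsto (fun j => δ (φ (ψH (ψ j)))) atTop (𝓝 0) :=
      hδ.comp ((hφ.comp (hψH.comp hψ)).tendsto_atTop)
    simpa using hWlim.sub h0
  have hatt : ‖curl (v (-1)) zbar‖ = Wbar :=
    tendsto_nhds_unique hconvω.norm
      (tendsto_of_tendsto_of_tendsto_of_le_of_le hlow hWlim (fun j => hnear' _) hup)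
  have hne : curl (v (-1)) zbar ≠ 0 := by
    rw [← norm_pos_iff, hatt]; linarith
  -- `v` is dominated by `Wbar` on `s ≤ -1/4`
  have hnumv : ∀ s ≤ -(1 / 4 : ℝ), ∀ y, (0 - s) * ‖curl (v s) y‖ ≤ (0 - (-1)) * ‖curl (v (-1)) zbar‖ := by
    intro s hs y
    have hs0 : s < 0 := by linarith
    have hlim := ((((hcurlmv s hs (fun _ => y) y tendsto_const_nhds).comp hψH').comp hψ').norm.const_mul
      (0 - s))
    have h := le_of_tendsto_of_tendsto' hlim hWlim fun j => hnum (φ (ψH (ψ j))) s hs0 y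
    rw [hatt]; linarith
  have hP : IsTypeITangentPeak C₀ v zbar := ⟨hvc, hvI, hweak, hne, hnumv⟩
  subst hu'
  exact ⟨v, zbar, hP, hatt ▸ hWbar0, hHv, fun j => φ (ψH (ψ j)), fun j => lam (φ (ψH (ψ j))),
    fun j => z (φ (ψH (ψ j))), hφ.comp (hψH.comp hψ), fun j => hlam0 _, fun j => hlam2 _, fun j => hxz _,
    hzlim, fun j => hne' _, hconvω, hconvA, hconvH⟩

end Summit.NavierStokesRegularity.NavierStokesRegularity.Theorems.StrainDoors
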